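import Mathlib

/-!
# Pattern-level BAL for theta graphs: sums of independent symmetric trinomial vectors
(seat mine-b, cell pub-perc-repro2; proofs/MINE-B-DUAL.md §6)

For a theta graph (internally disjoint `s–t` paths of lengths `ℓ₁, …, ℓ_m`) under the uniform
2-colouring, the pair (red flow, blue flow) `(F_R, F_B)` is a sum of independent vectors
`(Xᵢ, Yᵢ) ∈ {(1,0), (0,1), (0,0)}` with `P(1,0) = P(0,1) = 2^{-ℓᵢ} =: qᵢ` (path `i` all red / all
blue / mixed).  The joint tail `T_m(a,b) = P(F_R ≥ a, F_B ≥ b)` therefore obeys the recursion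
`T_{m+1}(a,b) = q_m T_m(a−1,b) + q_m T_m(a,b−1) + (1 − 2 q_m) T_m(a,b)`, `T_0(a,b) = 1[a ≤ 0 ∧ b ≤ 0]`.
We prove the balanced inequality `BAL(a,b): T_m(a−1, b+1) ≤ T_m(a, b)` for all `a ≤ b` (the
two-copy PATTERN-level form of row B2 of conjectures/MINE-B.md, for every pattern of every theta
graph), by induction on `m` using only the colour-swap symmetry `T_m(a,b) = T_m(b,a)`.  The
probability-level shadow (products of independent copies) is the series–parallel theorem
`SP.prob_balanced`; this statement is the stronger, complementary-colouring one.
-/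

namespace Summit.Ventures.PercRepro2.Theta

/-- the joint tail of the sum of `m` independent symmetric trinomial vectors with parameters `q 0, …, q (m-1)` -/
noncomputable def tail (q : ℕ → ℝ) : ℕ → ℤ → ℤ → ℝ
  | 0, a, b => if a ≤ 0 ∧ b ≤ 0 then 1 else 0
  | m + 1, a, b => q m * tail q m (a - 1) b + q m * tail q m a (b - 1) + (1 - 2 * q m) * tail q m a b

/-- colour-swap symmetry -/
theorem tail_symm (q : ℕ → ℝ) : ∀ (m : ℕ) (a b : ℤ), tail q m a b = tail q m b a
  | 0, a, b => by
      simp only [tail]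
      by_cases ha : a ≤ 0 <;> by_cases hb : b ≤ 0 <;> simp [ha, hb]
  | m + 1, a, b => by
      simp only [tail]
      rw [tail_symm q m (a - 1) b, tail_symm q m a (b - 1), tail_symm q m a b]
      ring

/-- the tail is nonnegative (parameters in `[0, 1/2]`) -/
theorem tail_nonneg (q : ℕ → ℝ) (hq : ∀ i, 0 ≤ q i ∧ q i ≤ 1 / 2) :
    ∀ (m : ℕ) (a b : ℤ), 0 ≤ tail q m a b
  | 0, a, b => by
      simp only [tail]; split_ifs <;> norm_num
  | m + 1, a, b => by
      simp only [tail]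
      have h1 := tail_nonneg q hq m (a - 1) b
      have h2 := tail_nonneg q hq m a (b - 1)
      have h3 := tail_nonneg q hq m a b
      have hqm := hq m
      have h4 : 0 ≤ 1 - 2 * q m := by linarith [hqm.2]
      exact add_nonneg (add_nonneg (mul_nonneg hqm.1 h1) (mul_nonneg hqm.1 h2)) (mul_nonneg h4 h3)

/-- **Pattern-level BAL for theta graphs**: `T(a−1, b+1) ≤ T(a, b)` whenever `a ≤ b`. -/
theorem tail_balanced (q : ℕ → ℝ) (hq : ∀ i, 0 ≤ q i ∧ q i ≤ 1 / 2) :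
    ∀ (m : ℕ) (a b : ℤ), a ≤ b → tail q m (a - 1) (b + 1) ≤ tail q m a b
  | 0, a, b, hab => by
      simp only [tail]
      have hb : ¬ (b + 1 ≤ 0) ∨ True := by tauto
      by_cases h : a - 1 ≤ 0 ∧ b + 1 ≤ 0
      · -- then b ≤ -1, a ≤ b ≤ -1 < 0 so the right side is 1 too
        have ha0 : a ≤ 0 := by omega
        have hb0 : b ≤ 0 := by omega
        simp [h, ha0, hb0]
      · simp only [h, if_false]
        split_ifs <;> norm_num
  | m + 1, a, b, hab => by
      simp only [tail]
      have hqm := hq m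
      have h0 : 0 ≤ q m := hqm.1
      have h4 : 0 ≤ 1 - 2 * q m := by linarith [hqm.2]
      -- the three terms
      have t3 : tail q m (a - 1) (b + 1) ≤ tail q m a b := tail_balanced q hq m a b hab
      have t2 : tail q m (a - 1) (b + 1 - 1) ≤ tail q m a (b - 1) := by
        have : b + 1 - 1 = b := by ring
        rw [this]
        -- T(a-1, b) ≤ T(a, b-1): BAL at (a, b-1) needs a ≤ b-1; if a = b use symmetry
        rcases lt_or_eq_of_le hab with h | h
        · have := tail_balanced q hq m a (b - 1) (by omega)
          have e : b - 1 + 1 = b := by ring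
          rw [e] at this; exact this
        · subst h; rw [tail_symm q m a (a - 1)]
      have t1 : tail q m (a - 1 - 1) (b + 1) ≤ tail q m (a - 1) b := by
        have := tail_balanced q hq m (a - 1) b (by omega)
        exact this
      calc q m * tail q m (a - 1 - 1) (b + 1) + q m * tail q m (a - 1) (b + 1 - 1)
            + (1 - 2 * q m) * tail q m (a - 1) (b + 1)
          ≤ q m * tail q m (a - 1) b + q m * tail q m a (b - 1) + (1 - 2 * q m) * tail q m a b := by
            have e1 := mul_le_mul_of_nonneg_left t1 h0
            have e2 := mul_le_mul_of_nonneg_left t2 h0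
            have e3 := mul_le_mul_of_nonneg_left t3 h4
            linarith

/-- the headline instance: `T(k−1, k+1) ≤ T(k, k)` — the pattern coefficient of row B2 is nonnegative on
every pattern of every theta graph -/
theorem tail_logconcave_center (q : ℕ → ℝ) (hq : ∀ i, 0 ≤ q i ∧ q i ≤ 1 / 2) (m : ℕ) (k : ℤ) :
    tail q m (k - 1) (k + 1) ≤ tail q m k k :=
  tail_balanced q hq m k k le_rfl

end Summit.Ventures.PercRepro2.Theta

/-! ## Increments in `{0,1}²`: the `(1,1)` step is harmless

If a strand may also contribute `(1,1)` (a red and a blue path inside the strand, with weight `r`),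
the same induction goes through: the new term compares `T(a−2, b)` with `T(a−1, b−1)`, which is BAL
at `(a−1, b−1)`. -/

namespace Summit.Ventures.PercRepro2.Theta

/-- joint tail of a sum of independent symmetric vectors in `{0,1}²`: `P(1,0) = P(0,1) = q_m`,
`P(1,1) = r_m`, `P(0,0) = 1 − 2 q_m − r_m` -/
noncomputable def tail2 (q r : ℕ → ℝ) : ℕ → ℤ → ℤ → ℝ
  | 0, a, b => if a ≤ 0 ∧ b ≤ 0 then 1 else 0
  | m + 1, a, b => q m * tail2 q r m (a - 1) b + q m * tail2 q r m a (b - 1)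
      + r m * tail2 q r m (a - 1) (b - 1) + (1 - 2 * q m - r m) * tail2 q r m a b

/-- colour-swap symmetry -/
theorem tail2_symm (q r : ℕ → ℝ) : ∀ (m : ℕ) (a b : ℤ), tail2 q r m a b = tail2 q r m b a
  | 0, a, b => by
      simp only [tail2]
      by_cases ha : a ≤ 0 <;> by_cases hb : b ≤ 0 <;> simp [ha, hb]
  | m + 1, a, b => by
      simp only [tail2]
      rw [tail2_symm q r m (a - 1) b, tail2_symm q r m a (b - 1), tail2_symm q r m (a - 1) (b - 1),
        tail2_symm q r m a b]
      ring

/-- **Pattern-level BAL for symmetric `{0,1}²`-valued increments**: `T(a−1, b+1) ≤ T(a, b)` for `a ≤ b`. -/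
theorem tail2_balanced (q r : ℕ → ℝ) (hq : ∀ i, 0 ≤ q i) (hr : ∀ i, 0 ≤ r i)
    (hsum : ∀ i, 2 * q i + r i ≤ 1) :
    ∀ (m : ℕ) (a b : ℤ), a ≤ b → tail2 q r m (a - 1) (b + 1) ≤ tail2 q r m a b
  | 0, a, b, hab => by
      simp only [tail2]
      by_cases h : a - 1 ≤ 0 ∧ b + 1 ≤ 0
      · have ha0 : a ≤ 0 := by omega
        have hb0 : b ≤ 0 := by omega
        simp [h, ha0, hb0]
      · simp only [h, if_false]
        split_ifs <;> norm_num
  | m + 1, a, b, hab => by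
      simp only [tail2]
      have h0 := hq m
      have hr0 := hr m
      have h4 : 0 ≤ 1 - 2 * q m - r m := by linarith [hsum m]
      have t3 : tail2 q r m (a - 1) (b + 1) ≤ tail2 q r m a b := tail2_balanced q r hq hr hsum m a b hab
      have t2 : tail2 q r m (a - 1) (b + 1 - 1) ≤ tail2 q r m a (b - 1) := by
        have e : b + 1 - 1 = b := by ring
        rw [e]
        rcases lt_or_eq_of_le hab with h | h
        · have := tail2_balanced q r hq hr hsum m a (b - 1) (by omega)
          have e2 : b - 1 + 1 = b := by ring
          rw [e2] at this; exact this
        · subst h; rw [tail2_symm q r m a (a - 1)]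
      have t1 : tail2 q r m (a - 1 - 1) (b + 1) ≤ tail2 q r m (a - 1) b :=
        tail2_balanced q r hq hr hsum m (a - 1) b (by omega)
      have t4 : tail2 q r m (a - 1 - 1) (b + 1 - 1) ≤ tail2 q r m (a - 1) (b - 1) := by
        have e : b + 1 - 1 = b - 1 + 1 := by ring
        rw [e]
        exact tail2_balanced q r hq hr hsum m (a - 1) (b - 1) (by omega)
      have e1 := mul_le_mul_of_nonneg_left t1 h0
      have e2 := mul_le_mul_of_nonneg_left t2 h0
      have e3 := mul_le_mul_of_nonneg_left t3 h4
      have e4 := mul_le_mul_of_nonneg_left t4 hr0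
      linarith

end Summit.Ventures.PercRepro2.Theta

/-! ## The series step is a product: BAL is closed under pointwise products of nonnegative tails -/

namespace Summit.Ventures.PercRepro2.Theta

/-- an abstract balanced tail: `T(a−1, b+1) ≤ T(a, b)` whenever `a ≤ b`, with `T ≥ 0` -/
def IsBalanced (T : ℤ → ℤ → ℝ) : Prop :=
  (∀ a b, 0 ≤ T a b) ∧ ∀ a b, a ≤ b → T (a - 1) (b + 1) ≤ T a b

/-- **series composition**: the joint tail of `(min(F_R¹,F_R²), min(F_B¹,F_B²))` of two independent
parts is the pointwise product, and BAL is preserved -/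
theorem IsBalanced.mul {T₁ T₂ : ℤ → ℤ → ℝ} (h₁ : IsBalanced T₁) (h₂ : IsBalanced T₂) :
    IsBalanced (fun a b => T₁ a b * T₂ a b) :=
  ⟨fun a b => mul_nonneg (h₁.1 a b) (h₂.1 a b),
   fun a b hab => mul_le_mul (h₁.2 a b hab) (h₂.2 a b hab) (h₂.1 _ _) (h₁.1 _ _)⟩

/-- the theta tails are balanced -/
theorem isBalanced_tail (q : ℕ → ℝ) (hq : ∀ i, 0 ≤ q i ∧ q i ≤ 1 / 2) (m : ℕ) :
    IsBalanced (tail q m) :=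
  ⟨fun a b => tail_nonneg q hq m a b, fun a b hab => tail_balanced q hq m a b hab⟩

end Summit.Ventures.PercRepro2.Theta

/-! ## Strands of edge-connectivity ≤ 2: the `(2,0)/(0,2)` increments, paid for by the strand's Reimer inequality

A strand of `s–t` edge-connectivity `2` contributes `(F_R, F_B) ∈ {(0,0),(1,0),(0,1),(1,1),(2,0),(0,2)}`
with weights `w00, w10, w10, w11, w20, w20` (colour-swap symmetry).  Adding it to a balanced tail keeps
BAL provided `w20 ≤ w11` — which is the strand's own pattern-level BK/Reimer inequality
`#{F_B ≥ 2} ≤ #{F_R ≥ 1, F_B ≥ 1}` (two disjoint blue paths → one red and one blue path): a published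
theorem (Reimer) for every graph strand.  Every two-terminal graph is the parallel composition of its
strands (the components of `G − {s,t}` with their attachments, plus the direct `s–t` edges), so this
gives the uniform two-colouring BAL (the fully-coloured pattern) for every graph all of whose strands
have edge-connectivity ≤ 2 — the Wheatstone bridge, `K₄` with adjacent terminals, … — beyond the
series–parallel class; for every product measure one needs it on every minor as well
(proofs/MINE-B-DUAL.md §7). -/

namespace Summit.Ventures.PercRepro2.Theta

/-- joint tail of a sum of independent symmetric vectors in `{(0,0),(1,0),(0,1),(1,1),(2,0),(0,2)}`
with weights `w00 m, w10 m, w10 m, w11 m, w20 m, w20 m` (the `m`-th strand) -/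
noncomputable def tail3 (w00 w10 w11 w20 : ℕ → ℝ) : ℕ → ℤ → ℤ → ℝ
  | 0, a, b => if a ≤ 0 ∧ b ≤ 0 then 1 else 0
  | m + 1, a, b => w00 m * tail3 w00 w10 w11 w20 m a b
      + w10 m * tail3 w00 w10 w11 w20 m (a - 1) b + w10 m * tail3 w00 w10 w11 w20 m a (b - 1)
      + w11 m * tail3 w00 w10 w11 w20 m (a - 1) (b - 1)
      + w20 m * tail3 w00 w10 w11 w20 m (a - 2) b + w20 m * tail3 w00 w10 w11 w20 m a (b - 2)

/-- colour-swap symmetry -/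
theorem tail3_symm (w00 w10 w11 w20 : ℕ → ℝ) :
    ∀ (m : ℕ) (a b : ℤ), tail3 w00 w10 w11 w20 m a b = tail3 w00 w10 w11 w20 m b a
  | 0, a, b => by
      simp only [tail3]
      by_cases ha : a ≤ 0 <;> by_cases hb : b ≤ 0 <;> simp [ha, hb]
  | m + 1, a, b => by
      simp only [tail3]
      rw [tail3_symm w00 w10 w11 w20 m a b, tail3_symm w00 w10 w11 w20 m (a - 1) b,
        tail3_symm w00 w10 w11 w20 m a (b - 1), tail3_symm w00 w10 w11 w20 m (a - 1) (b - 1),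
        tail3_symm w00 w10 w11 w20 m (a - 2) b, tail3_symm w00 w10 w11 w20 m a (b - 2)]
      ring

/-- **Pattern-level BAL for parallel compositions of strands of edge-connectivity ≤ 2**:
`T(a−1, b+1) ≤ T(a, b)` for `a ≤ b`, given nonnegative weights with `w20 ≤ w11` (Reimer for the strand). -/
theorem tail3_balanced (w00 w10 w11 w20 : ℕ → ℝ) (h00 : ∀ i, 0 ≤ w00 i) (h10 : ∀ i, 0 ≤ w10 i)
    (h11 : ∀ i, 0 ≤ w11 i) (h20 : ∀ i, 0 ≤ w20 i) (hR : ∀ i, w20 i ≤ w11 i) :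
    ∀ (m : ℕ) (a b : ℤ), a ≤ b → tail3 w00 w10 w11 w20 m (a - 1) (b + 1) ≤ tail3 w00 w10 w11 w20 m a b
  | 0, a, b, hab => by
      simp only [tail3]
      by_cases h : a - 1 ≤ 0 ∧ b + 1 ≤ 0
      · have ha0 : a ≤ 0 := by omega
        have hb0 : b ≤ 0 := by omega
        simp [h, ha0, hb0]
      · simp only [h, if_false]
        split_ifs <;> norm_num
  | m + 1, a, b, hab => by
      simp only [tail3]
      set T := tail3 w00 w10 w11 w20 m with hT
      have IH : ∀ a b : ℤ, a ≤ b → T (a - 1) (b + 1) ≤ T a b :=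
        fun a b h => tail3_balanced w00 w10 w11 w20 h00 h10 h11 h20 hR m a b h
      have sym : ∀ a b : ℤ, T a b = T b a := fun a b => tail3_symm w00 w10 w11 w20 m a b
      -- the six comparisons
      have c00 : T (a - 1) (b + 1) ≤ T a b := IH a b hab
      have c10a : T (a - 1 - 1) (b + 1) ≤ T (a - 1) b := IH (a - 1) b (by omega)
      have c10b : T (a - 1) (b + 1 - 1) ≤ T a (b - 1) := by
        have e : b + 1 - 1 = b := by ring
        rw [e]
        rcases lt_or_eq_of_le hab with h | h
        · have := IH a (b - 1) (by omega)
          have e2 : b - 1 + 1 = b := by ring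
          rw [e2] at this; exact this
        · subst h; rw [sym a (a - 1)]
      have c11 : T (a - 1 - 1) (b + 1 - 1) ≤ T (a - 1) (b - 1) := by
        have e : b + 1 - 1 = b - 1 + 1 := by ring
        rw [e]; exact IH (a - 1) (b - 1) (by omega)
      have c20a : T (a - 1 - 2) (b + 1) ≤ T (a - 2) b := by
        have e : a - 1 - 2 = a - 2 - 1 := by ring
        rw [e]; exact IH (a - 2) b (by omega)
      -- the (0,2) increment: fine when a ≤ b − 2 or b = a + 1; at b = a it is paid by the (1,1) term
      have key : w20 m * T (a - 1) (b + 1 - 2) + w11 m * T (a - 1 - 1) (b + 1 - 1)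
          ≤ w20 m * T a (b - 2) + w11 m * T (a - 1) (b - 1) := by
        have e1 : b + 1 - 2 = b - 1 := by ring
        have e2 : b + 1 - 1 = b := by ring
        rw [e1, e2]
        rcases lt_or_eq_of_le hab with h | h
        · rcases lt_or_eq_of_le (show a + 1 ≤ b by omega) with h' | h'
          · -- a ≤ b − 2: both increments separately
            have d1 : T (a - 1) (b - 1) ≤ T a (b - 2) := by
              have := IH a (b - 2) (by omega)
              have e3 : b - 2 + 1 = b - 1 := by ring
              rw [e3] at this; exact this
            have d2 : T (a - 1 - 1) b ≤ T (a - 1) (b - 1) := by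
              have := IH (a - 1) (b - 1) (by omega)
              have e3 : b - 1 + 1 = b := by ring
              rw [e3] at this; exact this
            have := mul_le_mul_of_nonneg_left d1 (h20 m)
            have := mul_le_mul_of_nonneg_left d2 (h11 m)
            linarith
          · -- b = a + 1: the (0,2) term is an equality by symmetry
            subst h'
            have d1 : T (a - 1) (a + 1 - 1) = T a (a + 1 - 2) := by
              have e3 : a + 1 - 1 = a := by ring
              have e4 : a + 1 - 2 = a - 1 := by ring
              rw [e3, e4, sym]
            have d2 : T (a - 1 - 1) (a + 1) ≤ T (a - 1) (a + 1 - 1) := by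
              have := IH (a - 1) (a + 1 - 1) (by omega)
              have e3 : a + 1 - 1 = a := by ring
              rw [e3] at this ⊢
              simpa using this
            have hw11 := mul_le_mul_of_nonneg_left d2 (h11 m)
            have hd : w20 m * T (a - 1) (a + 1 - 1) = w20 m * T a (a + 1 - 2) := by rw [d1]
            linarith
        · -- b = a: pay the (0,2) defect with the (1,1) term
          subst h
          have gap : T (a - 2) a ≤ T (a - 1) (a - 1) := by
            have := IH (a - 1) (a - 1) le_rfl
            have e3 : a - 1 - 1 = a - 2 := by ring
            have e4 : a - 1 + 1 = a := by ring
            rw [e3, e4] at this; exact this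
          have e5 : T a (a - 2) = T (a - 2) a := sym a (a - 2)
          have e6 : T (a - 1 - 1) a = T (a - 2) a := by
            have e3 : a - 1 - 1 = a - 2 := by ring
            rw [e3]
          rw [e5, e6]
          have hw := hR m
          have hnn : 0 ≤ T (a - 1) (a - 1) - T (a - 2) a := by linarith
          have := mul_le_mul_of_nonneg_right hw hnn
          linarith
      have e00 := mul_le_mul_of_nonneg_left c00 (h00 m)
      have e10a := mul_le_mul_of_nonneg_left c10a (h10 m)
      have e10b := mul_le_mul_of_nonneg_left c10b (h10 m)
      have e20a := mul_le_mul_of_nonneg_left c20a (h20 m)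
      linarith [key, e00, e10a, e10b, e20a, mul_le_mul_of_nonneg_left c11 (h11 m)]

end Summit.Ventures.PercRepro2.Theta
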